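import Literature.AlgebraicGeometry.Resolution.CoordinateBlowupProperTransform
import HarnessLib

/-!
# Towers of coordinate blow-ups of affine space: total and proper transforms (Hu 2025, §5.1, §5.3–5.5, §6)

Topic: `Literature/AlgebraicGeometry/Resolution`. Companion of `CoordinateBlowupChart.lean`
(Prop. 5.3: the chart of `Bl_{V(X_A)} 𝔸^σ_S` over `X_{i₀}` is `𝔸^σ_S` again, structure map the
substitution `coordBlowupSubst`) and `CoordinateBlowupProperTransform.lean` (Def. 5.4: the proper
transform `coordProperTransform`, `π* f = ζ^l · f_𝔙`). In Y. Hu, *Universal characteristic-free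
resolution of singularities, I* (arXiv:2507.21400), the ambient tower
`𝓡̃_ℓ → ⋯ → 𝓡̃_{℘} → ⋯ → 𝓡̃_{ϑ_{[k]}} → ⋯ → 𝓡 = 𝕌 × ∏ ℙ_F` (§5.3 (5.8), §6) is, chart by chart, a
SEQUENCE of such coordinate blow-ups: every centre is the intersection of two coordinate
hyperplanes of the current chart (the `ϑ`-centres `Z_{ϑ_u} = X_u ∩ X_{((123),u)}`, Def. 5.9; the
`℘`-centres, §6), and every standard chart of every `𝓡̃` is an affine space with the SAME number of
free variables (Prop. 5.3, Prop. 5.11 ff.: "`𝔙` comes equipped with the free variables …").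
Hence, once the variable set `σ` is fixed, **a standard chart of the tower is a word of steps
`(A_t, i_t ∈ A_t)` and its coordinate ring is `S[X_σ]` at every level**; the structure map to
level `0` is the composite substitution and the equations move by iterated proper transform
(Def. 5.4 applied inductively, as Hu does: "`B_𝔙 = (π*_{𝔙,𝔙'} B_{𝔙'}) / ζ^{l}`" at each step).

This file sets up that bookkeeping once and for all and PROVES its invariants:

* `CoordBlowupStep σ` — a step `(A, i₀ ∈ A)`; `towerSubst S w` — the total transform
  `π*_w : S[X_σ] →ₐ[S] S[X_σ]` of the word `w` (first letter = first blow-up);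
  `towerProperTransform S w f` — the iterated proper transform `f_𝔙`; `towerExcFactor S w f` —
  the accumulated exceptional monomial;
* `towerSubst_eq_towerExcFactor_mul` — **`π*_w f = (exceptional monomial) · f_𝔙`**;
  `towerSubst_monomial`, `towerExcFactor_eq_monomial` — pull-backs of monomials and the
  exceptional factor are MONOMIALS (unit coefficient for the latter);
* `towerProperTransform_eq_sum` — **`f_𝔙 = Σ_{d ∈ supp f} c_d X^{φ d}` for an exponent map `φ`
  injective on `supp f`**: the proper transform has the same number of terms and the same
  coefficients (so binomials stay binomials, `towerProperTransform_monomial_sub_monomial`, and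
  `L_F` keeps its `±1` coefficients — the shape statements of Prop. 5.12 ff. and §6);
* `towerProperTransform_mul` (over a domain: `(fg)_𝔙 = f_𝔙 g_𝔙`), `towerProperTransform_ne_zero`,
  `towerProperTransform_C`.

Everything is proved; no named facts (D-0026).

## References

* Y. Hu, *Universal Characteristic-free Resolution of Singularities, I*, arXiv:2507.21400 (2025),
  §5.1 Def. 5.1–5.4, Prop. 5.3, §5.3 Def. 5.9 and (5.8), Prop. 5.11–5.12, §6 (theorem numbers of
  the arXiv v1 TeX source). [Hu2025]
* The Stacks Project, Tag 080C (strict transform), Tag 085S (blowing up and composition). [StacksProject]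
-/

noncomputable section

open MvPolynomial

namespace Literature.AlgebraicGeometry.Resolution

universe u v

/-- **One coordinate blow-up step seen from a standard chart**: centre `V(X_i : i ∈ A)`, chart over
the generator `X_{i₀}`, `i₀ ∈ A` (which becomes the exceptional variable `ζ`).
[cite: Hu2025, §5.1 Def. 5.1 and Prop. 5.3] -/
structure CoordBlowupStep (σ : Type v) where
  /-- the coordinates cutting out the centre -/
  A : Set σ
  /-- the coordinate the chart lies over (the exceptional variable of the chart) -/
  i₀ : σ
  /-- `i₀ ∈ A` -/
  mem : i₀ ∈ A

variable (S : Type u) [CommRing S] {σ : Type v}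

/-- **The total transform `π*_w`** to the standard chart indexed by the word `w` (head = first
blow-up): the composite of the blow-up substitutions. [cite: Hu2025, §5.1 Def. 5.4 and (5.8)] -/
def towerSubst : List (CoordBlowupStep σ) → (MvPolynomial σ S →ₐ[S] MvPolynomial σ S)
  | [] => AlgHom.id S _
  | st :: w => (towerSubst w).comp (coordBlowupSubst S st.A st.i₀)

/-- **The iterated proper transform `f_𝔙`** along the word `w` (Def. 5.4 applied at each step).
[cite: Hu2025, §5.1 Def. 5.4] -/
def towerProperTransform : List (CoordBlowupStep σ) → MvPolynomial σ S → MvPolynomial σ S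
  | [] => id
  | st :: w => fun f => towerProperTransform w (coordProperTransform S st.A st.i₀ f)

/-- **The accumulated exceptional factor** of `f` along `w`: `ζ₁^{l₁}` pulled back along the rest
of the word, times the factor of `f_{𝔙₁}` along the rest. [cite: Hu2025, §5.1 Def. 5.4] -/
def towerExcFactor : List (CoordBlowupStep σ) → MvPolynomial σ S → MvPolynomial σ S
  | [] => fun _ => 1
  | st :: w => fun f =>
    towerSubst S w (X st.i₀ ^ centreOrder st.A f) * towerExcFactor w (coordProperTransform S st.A st.i₀ f)

/-- The empty word: no blow-up. [folklore] -/
@[simp] theorem towerSubst_nil (f : MvPolynomial σ S) : towerSubst S ([] : List (CoordBlowupStep σ)) f = f := rfl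

/-- Unfolding the total transform along `st :: w`. [folklore] -/
@[simp] theorem towerSubst_cons (st : CoordBlowupStep σ) (w : List (CoordBlowupStep σ)) (f : MvPolynomial σ S) :
    towerSubst S (st :: w) f = towerSubst S w (coordBlowupSubst S st.A st.i₀ f) := rfl

/-- The empty word: `f_𝔙 = f`. [folklore] -/
@[simp] theorem towerProperTransform_nil (f : MvPolynomial σ S) :
    towerProperTransform S ([] : List (CoordBlowupStep σ)) f = f := rfl

/-- Unfolding the proper transform along `st :: w`. [folklore] -/
@[simp] theorem towerProperTransform_cons (st : CoordBlowupStep σ) (w : List (CoordBlowupStep σ))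
    (f : MvPolynomial σ S) :
    towerProperTransform S (st :: w) f = towerProperTransform S w (coordProperTransform S st.A st.i₀ f) := rfl

/-- The empty word: exceptional factor `1`. [folklore] -/
@[simp] theorem towerExcFactor_nil (f : MvPolynomial σ S) :
    towerExcFactor S ([] : List (CoordBlowupStep σ)) f = 1 := rfl

/-- Unfolding the exceptional factor along `st :: w`. [folklore] -/
@[simp] theorem towerExcFactor_cons (st : CoordBlowupStep σ) (w : List (CoordBlowupStep σ))
    (f : MvPolynomial σ S) :
    towerExcFactor S (st :: w) f =
      towerSubst S w (X st.i₀ ^ centreOrder st.A f) *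
        towerExcFactor S w (coordProperTransform S st.A st.i₀ f) := rfl

/-- **`π*_w f = (exceptional factor) · f_𝔙`**: the total transform is the accumulated exceptional
monomial times the iterated proper transform. [cite: Hu2025, §5.1 Def. 5.4] -/
theorem towerSubst_eq_towerExcFactor_mul (w : List (CoordBlowupStep σ)) (f : MvPolynomial σ S) :
    towerSubst S w f = towerExcFactor S w f * towerProperTransform S w f := by
  induction w generalizing f with
  | nil => simp
  | cons st w ih =>
    rw [towerSubst_cons, coordBlowupSubst_eq_X_pow_mul_coordProperTransform S st.A st.i₀ st.mem f,
      map_mul, ih (coordProperTransform S st.A st.i₀ f), towerExcFactor_cons, towerProperTransform_cons,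
      mul_assoc]

/-- **Pull-backs of monomials are monomials** (with the same coefficient): the structure maps of
the tower are monomial substitutions. [cite: Hu2025, §5.1 Prop. 5.3] -/
theorem towerSubst_monomial (w : List (CoordBlowupStep σ)) (d : σ →₀ ℕ) (c : S) :
    ∃ d' : σ →₀ ℕ, towerSubst S w (monomial d c) = monomial d' c := by
  induction w generalizing d with
  | nil => exact ⟨d, rfl⟩
  | cons st w ih =>
    rw [towerSubst_cons, coordBlowupSubst_monomial S st.A st.i₀ st.mem, X_pow_eq_monomial,
      monomial_mul, one_mul]
    exact ih _

/-- **The exceptional factor is a monomial with coefficient `1`** (a product of exceptional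
variables pulled back along the tower). [cite: Hu2025, §5.1 Def. 5.4] -/
theorem towerExcFactor_eq_monomial (w : List (CoordBlowupStep σ)) (f : MvPolynomial σ S) :
    ∃ d : σ →₀ ℕ, towerExcFactor S w f = monomial d 1 := by
  induction w generalizing f with
  | nil => exact ⟨0, rfl⟩
  | cons st w ih =>
    obtain ⟨d₁, hd₁⟩ := towerSubst_monomial S w (Finsupp.single st.i₀ (centreOrder st.A f)) 1
    obtain ⟨d₂, hd₂⟩ := ih (coordProperTransform S st.A st.i₀ f)
    refine ⟨d₁ + d₂, ?_⟩
    rw [towerExcFactor_cons, X_pow_eq_monomial, hd₁, hd₂, monomial_mul, one_mul]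

/-- Constants are their own proper transforms. [folklore] -/
@[simp] theorem towerProperTransform_C (w : List (CoordBlowupStep σ)) (c : S) :
    towerProperTransform S w (C c : MvPolynomial σ S) = C c := by
  induction w with
  | nil => rfl
  | cons st w ih => rw [towerProperTransform_cons, coordProperTransform_C, ih]

/-- `0_𝔙 = 0`. [folklore] -/
@[simp] theorem towerProperTransform_zero (w : List (CoordBlowupStep σ)) :
    towerProperTransform S w (0 : MvPolynomial σ S) = 0 := by
  rw [← C_0, towerProperTransform_C]

/-- **The proper transform of a non-zero polynomial is non-zero.** [cite: Hu2025, §5.1 Def. 5.4] -/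
theorem towerProperTransform_ne_zero (w : List (CoordBlowupStep σ)) {f : MvPolynomial σ S} (hf : f ≠ 0) :
    towerProperTransform S w f ≠ 0 := by
  induction w generalizing f with
  | nil => exact hf
  | cons st w ih => exact ih (coordProperTransform_ne_zero S st.A st.i₀ st.mem hf)

/-- **Proper transforms along the tower are multiplicative** (over a domain).
[cite: Hu2025, §5.1 Def. 5.4 and Lemma 5.5] -/
theorem towerProperTransform_mul [IsDomain S] (w : List (CoordBlowupStep σ)) (f g : MvPolynomial σ S) :
    towerProperTransform S w (f * g) = towerProperTransform S w f * towerProperTransform S w g := by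
  induction w generalizing f g with
  | nil => rfl
  | cons st w ih => rw [towerProperTransform_cons, coordProperTransform_mul S st.A st.i₀ st.mem, ih]; rfl

/-- **Shape of the proper transform: same support size, same coefficients.** There is an exponent
map `φ`, injective on `supp f`, with `f_𝔙 = Σ_{d ∈ supp f} c_d(f) X^{φ d}`; in particular `f_𝔙`
has exactly as many terms as `f`, with the same coefficients (Lemma 5.5: divisibility of the terms
by the non-exceptional variables is also preserved, step by step).
[cite: Hu2025, §5.1 Def. 5.4 and Lemma 5.5] -/
theorem towerProperTransform_eq_sum (w : List (CoordBlowupStep σ)) (f : MvPolynomial σ S) :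
    ∃ φ : (σ →₀ ℕ) → (σ →₀ ℕ), Set.InjOn φ f.support ∧
      towerProperTransform S w f = ∑ d ∈ f.support, monomial (φ d) (coeff d f) := by
  classical
  induction w generalizing f with
  | nil => exact ⟨id, Set.injOn_id _, by simp⟩
  | cons st w ih =>
    obtain ⟨ψ, hψ, hsum⟩ := ih (coordProperTransform S st.A st.i₀ f)
    -- step map: `d ↦ coordTransformExp A i₀ l d`, injective on `supp f`
    set θ : (σ →₀ ℕ) → (σ →₀ ℕ) := coordTransformExp st.A st.i₀ (centreOrder st.A f) with hθ
    have hθinj : Set.InjOn θ f.support := fun d hd e he h =>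
      coordTransformExp_injective_of_le st.A st.i₀ st.mem _ (centreOrder_le S st.A hd)
        (centreOrder_le S st.A he) h
    have hsupp : (coordProperTransform S st.A st.i₀ f).support = f.support.image θ :=
      support_coordProperTransform S st.A st.i₀ st.mem f
    refine ⟨ψ ∘ θ, ?_, ?_⟩
    · intro d hd e he h
      refine hθinj hd he (hψ ?_ ?_ h)
      · rw [hsupp]; exact Finset.mem_image_of_mem θ hd
      · rw [hsupp]; exact Finset.mem_image_of_mem θ he
    · rw [towerProperTransform_cons, hsum, hsupp, Finset.sum_image fun d hd e he h => hθinj hd he h]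
      refine Finset.sum_congr rfl fun d hd => ?_
      rw [Function.comp_apply, hθ, coeff_coordTransformExp_coordProperTransform S st.A st.i₀ st.mem hd]

/-- **Binomials stay binomials**: the proper transform along the tower of `a X^d - b X^e`
(`d ≠ e`, `a, b ≠ 0`) is `a X^{d'} - b X^{e'}` with `d' ≠ e'` ("`B_𝔙`, a binomial in `Var_𝔙`").
[cite: Hu2025, §5.1 Def. 5.4] -/
theorem towerProperTransform_monomial_sub_monomial (w : List (CoordBlowupStep σ)) {d e : σ →₀ ℕ}
    (hde : d ≠ e) {a b : S} (ha : a ≠ 0) (hb : b ≠ 0) :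
    ∃ d' e' : σ →₀ ℕ, d' ≠ e' ∧
      towerProperTransform S w (monomial d a - monomial e b) = monomial d' a - monomial e' b := by
  classical
  obtain ⟨φ, hφ, hsum⟩ := towerProperTransform_eq_sum S w (monomial d a - monomial e b)
  have hsupp := support_monomial_sub_monomial S hde ha hb
  refine ⟨φ d, φ e, fun h => hde (hφ ?_ ?_ h), ?_⟩
  · rw [hsupp]; exact Finset.mem_insert_self _ _
  · rw [hsupp]; exact Finset.mem_insert_of_mem (Finset.mem_singleton_self _)
  · rw [hsum, hsupp, Finset.sum_pair hde, coeff_sub, coeff_sub, coeff_monomial, coeff_monomial,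
      coeff_monomial, coeff_monomial, if_pos rfl, if_neg (Ne.symm hde), if_neg hde, if_pos rfl,
      sub_zero, zero_sub, map_neg, sub_eq_add_neg]

end Literature.AlgebraicGeometry.Resolution

end
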